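import Mathlib
import Summits.Ventures.HodgeRepro.Tier4.Common.AdelicDefs
import Summits.Ventures.HodgeRepro.Tier4.Common.CompactOpenLevel

/-!
# Tier4/Line4/LevelPrime — C-L4-LEVELPRIME: the choice of the level prime

Blind re-derivation cell `pub-hodge-repro`, Tier 4 «prove the step» (README §9–§10), seat t4-L1-p1 (prover, LINE L1,
gen 4; plan-4 g5's cut by name S15378).  Tree path `lean/Summits/Ventures/HodgeRepro/Tier4/Line4/LevelPrime.lean`.
Mathlib-level; no literature.

WHAT IS PROVED (every declaration sorry-free, axioms `[propext, Classical.choice, Quot.sound]`).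
* `finite_not_integral (y : FiniteAdeleRing (𝓞 k) k)` — a finite adele is integral at all but finitely many places
  (the restricted-product condition, `RestrictedProduct.eventually`).
* `badPlaces γ₀` — the places `v` where some entry of `γ₀` or of `γ₀⁻¹` is not `v`-integral — is FINITE for EVERY
  `γ₀ ∈ G(𝔸)` (`finite_badPlaces`: the union of the 32 finite sets above; no rationality needed).
* `natSize_lt_one_iff : natSize k v N < 1 ↔ (N : 𝓞 k) ∈ v.asIdeal` (the valuation–divisibility dictionary); two
  distinct rational primes are never both in a non-zero prime of `𝓞 k` (`subsingleton_primes_mem_asIdeal`, Bézout);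
  hence `badPrimes γ₀` — the rational primes below a bad place — is finite (`finite_badPrimes`).
* **`exists_levelPrime (γ₀ : GA W) : ∃ p : ℕ, p.Prime ∧ ∀ v, natSize k v p < 1 → ∀ i j,
  Valued.v (finPart k (GA.mat W γ₀ i j) v) ≤ 1 ∧ Valued.v (finPart k (GA.mat W γ₀⁻¹ i j) v) ≤ 1`** — a rational prime
  `p` above no bad place (`Nat.exists_infinite_primes` beyond the finite `badPrimes`): the RAW per-place hypothesis of
  L4-p2's `levelDoubleCoset_measure_le` (S15342 (3)) is met by the CHOICE of the level prime, after `γ₀` — so the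
  witness of `TailForArch'''` (`lev n := p ^ (n + n₁)`) carries NO integrality clause on `γ₀` (lead (R-35), plan-4
  S15355 (1)).  The consumer applies it at `GA.ofFinPart W γ₀` (its finite part, an element of `G(𝔸)` like any other).

Junk: none — the statement holds for every `γ₀ ∈ G(𝔸)`, with no hypothesis.

Nothing here says anything about the status of the Hodge conjecture for CM abelian varieties, which is NOT proved
(HC_CM is NOT proved by anyone in this repository).
-/

set_option autoImplicit false
noncomputable section
namespace Summit.Ventures.HodgeRepro.Tier4.Line4
open Summit.Ventures.HodgeRepro.Tier4 Summit.Ventures.HodgeRepro.Tier4.Common NumberField IsDedekindDomain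
open scoped NumberField

section LevelPrime

variable {k : Type} [Field k] [NumberField k]

/-- **a finite adele is integral at all but finitely many places** (the restricted-product condition). -/
theorem finite_not_integral (y : FiniteAdeleRing (𝓞 k) k) :
    {v : HeightOneSpectrum (𝓞 k) | ¬ Valued.v (y v) ≤ 1}.Finite := by
  have h := Filter.eventually_cofinite.1 y.eventually
  exact h.subset fun v hv hmem => hv ((HeightOneSpectrum.mem_adicCompletionIntegers (𝓞 k) k v).1 hmem)

/-- **`natSize k v N < 1` iff `N ∈ v`** (the valuation–divisibility dictionary for a natural number). -/
theorem natSize_lt_one_iff (v : HeightOneSpectrum (𝓞 k)) (N : ℕ) :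
    natSize k v N < 1 ↔ (N : 𝓞 k) ∈ v.asIdeal := by
  unfold natSize
  rw [HeightOneSpectrum.valuedAdicCompletion_eq_valuation' v (N : k)]
  have h : ((N : k)) = algebraMap (𝓞 k) k (N : 𝓞 k) := by simp
  rw [h, HeightOneSpectrum.valuation_lt_one_iff_dvd, Ideal.dvd_span_singleton]

omit [NumberField k] in
/-- **two distinct rational primes never lie in the same non-zero prime of `𝓞 k`** (Bézout: `1 = a p + b q`). -/
theorem subsingleton_primes_mem_asIdeal (v : HeightOneSpectrum (𝓞 k)) :
    {p : ℕ | p.Prime ∧ (p : 𝓞 k) ∈ v.asIdeal}.Subsingleton := by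
  intro p hp q hq
  by_contra hne
  have hcop : Nat.Coprime p q := (Nat.coprime_primes hp.1 hq.1).2 hne
  have hbez := Int.gcd_eq_gcd_ab (p : ℤ) (q : ℤ)
  have hg : Int.gcd (p : ℤ) (q : ℤ) = 1 := by
    rw [Int.gcd_natCast_natCast]
    exact hcop
  rw [hg] at hbez
  have h1 : (1 : 𝓞 k) ∈ v.asIdeal := by
    have hcast := congrArg (fun z : ℤ => (z : 𝓞 k)) hbez
    simp only [Nat.cast_one, Int.cast_one, Int.cast_add, Int.cast_mul, Int.cast_natCast] at hcast
    rw [hcast]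
    exact v.asIdeal.add_mem (v.asIdeal.mul_mem_right _ hp.2) (v.asIdeal.mul_mem_right _ hq.2)
  exact v.isPrime.ne_top ((Ideal.eq_top_iff_one _).2 h1)

variable (W : PlaneData k)

/-- **the bad places of `γ₀`**: where some entry of `γ₀` or of `γ₀⁻¹` is not `v`-integral. -/
def badPlaces (γ₀ : GA W) : Set (HeightOneSpectrum (𝓞 k)) :=
  {v | ∃ i j : Fin 4, ¬ (Valued.v (finPart k (GA.mat W γ₀ i j) v) ≤ 1 ∧
    Valued.v (finPart k (GA.mat W γ₀⁻¹ i j) v) ≤ 1)}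

/-- **the bad places of any `γ₀ ∈ G(𝔸)` are finitely many** (32 finite adeles). -/
theorem finite_badPlaces (γ₀ : GA W) : (badPlaces W γ₀).Finite := by
  have hsub : badPlaces W γ₀ ⊆ ⋃ i : Fin 4, ⋃ j : Fin 4,
      ({v : HeightOneSpectrum (𝓞 k) | ¬ Valued.v (finPart k (GA.mat W γ₀ i j) v) ≤ 1} ∪
        {v : HeightOneSpectrum (𝓞 k) | ¬ Valued.v (finPart k (GA.mat W γ₀⁻¹ i j) v) ≤ 1}) := by
    rintro v ⟨i, j, h⟩
    simp only [Set.mem_iUnion, Set.mem_union, Set.mem_setOf_eq]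
    exact ⟨i, j, not_and_or.1 h⟩
  refine Set.Finite.subset ?_ hsub
  exact Set.finite_iUnion fun i => Set.finite_iUnion fun j =>
    (finite_not_integral _).union (finite_not_integral _)

/-- **the bad primes of `γ₀`**: the rational primes below a bad place. -/
def badPrimes (γ₀ : GA W) : Set ℕ := {p | p.Prime ∧ ∃ v ∈ badPlaces W γ₀, natSize k v p < 1}

/-- **the bad primes are finitely many** (one rational prime at most below each of the finitely many bad places). -/
theorem finite_badPrimes (γ₀ : GA W) : (badPrimes W γ₀).Finite := by
  have hsub : badPrimes W γ₀ ⊆ ⋃ v ∈ badPlaces W γ₀, {p : ℕ | p.Prime ∧ (p : 𝓞 k) ∈ v.asIdeal} := by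
    rintro p ⟨hp, v, hv, hlt⟩
    simp only [Set.mem_iUnion, Set.mem_setOf_eq]
    exact ⟨v, hv, hp, (natSize_lt_one_iff v p).1 hlt⟩
  exact ((finite_badPlaces W γ₀).biUnion fun v _ => (subsingleton_primes_mem_asIdeal v).finite).subset hsub

/-- **C-L4-LEVELPRIME — the choice of the level prime**: for every `γ₀ ∈ G(𝔸)` there is a rational prime `p` such that
`γ₀` and `γ₀⁻¹` are `v`-integral at every place `v` above `p` — the RAW hypothesis of L4-p2's
`levelDoubleCoset_measure_le` (S15342 (3)), met by the choice of `p` after `γ₀`; apply at `GA.ofFinPart W γ₀` for the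
finite part. -/
theorem exists_levelPrime (γ₀ : GA W) :
    ∃ p : ℕ, p.Prime ∧ ∀ v : HeightOneSpectrum (𝓞 k), natSize k v p < 1 → ∀ i j : Fin 4,
      Valued.v (finPart k (GA.mat W γ₀ i j) v) ≤ 1 ∧ Valued.v (finPart k (GA.mat W γ₀⁻¹ i j) v) ≤ 1 := by
  obtain ⟨M, hM⟩ := (finite_badPrimes W γ₀).bddAbove
  obtain ⟨p, hpM, hp⟩ := Nat.exists_infinite_primes (M + 1)
  refine ⟨p, hp, fun v hv i j => ?_⟩
  by_contra hbad
  have hvbad : v ∈ badPlaces W γ₀ := ⟨i, j, hbad⟩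
  have hpbad : p ∈ badPrimes W γ₀ := ⟨hp, v, hvbad, hv⟩
  have := hM hpbad
  omega

end LevelPrime

end Summit.Ventures.HodgeRepro.Tier4.Line4

end
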